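import Literature.AlgebraicGeometry.Frobenioids.PadicFrobenioidStandardType
import Literature.AlgebraicGeometry.Frobenioids.ModelFrobenioidNoAnchors
import HarnessLib

/-!
# Frobenioids II, Theorem 1.2 (i), third sentence, STANDARD-TYPE half — for EVERY datum, WITHOUT
# "`Φ`, `B` monoids on `D`": a `p`-adic Frobenioid is of standard type iff its base is of FSMFF-type

Mochizuki, *The geometry of Frobenioids II: poly-Frobenioids*, Kyushu J. Math. **62** (2008) 401–460, §1,
Theorem 1.2 (i), third sentence, kurims p. 9 [cite: MochizukiFrdII2008, Thm 1.2 (i) p.9]: "If `D` is of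
FSMFF-type, then `C` is of rationally standard type", printed proof p. 9: "(since `Φ` is non-dilating) it
follows from [FrdI], Theorem 5.2, (iii), that `C` is of standard type"; [FrdI] Thm. 5.2 (iii) p. 101
[cite: MochizukiFrdI2008, Thm. 5.2 (iii) p.101].

PROOF-ONLY companion (abc-iut cell, seat abc-iut-f-047, F fact-proving wave FLOAT; node FrdII:Thm1.2(i)).
Seat abc-iut-L1-d10's `Datum.thm12_isOfStandardType (h : d.IsMonoidData) (hD : IsOfFSMFFType D)` goes
through `ModelFrobenioid.standardTypeIff_holds`, which needs the standing hypotheses of [FrdI] Thm. 5.2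
(`Φ`, `B` monoids on `D` — `d.IsMonoidData`, not automatic over a base that is not of FSM-type) for the
"quasi-isotropic" clause (Rem. 3.1.1 for the FROBENIOID `C`). Seat abc-iut-w4-d084's
`ModelFrobenioid.data_isOfStandardType_of` / `data_isOfStandardType_iff` (`ModelFrobenioidNoAnchors.lean`)
prove [FrdI] Thm. 5.2 (iii) for ANY model category with sharp `Φ(A)`, group-like `B` and totally epimorphic
`D` (no anchors ⇒ no iso-subanchors). For the datum of a `p`-adic Frobenioid all three hold unconditionally
(`Φ(A)` monoprime hence sharp; `B(A) = K^× ×_{Φ₀^gp} Φ^gp` group-like; `D` totally epimorphic by definition),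
`Φ ≠ 0` and `Φ` is non-dilating (`Datum.not_isZeroMonoid`, `Datum.isNonDilatingOn`, seat abc-iut-L1-d10).
Hence, for EVERY datum `d` (no `IsMonoidData`): `thm12_isOfStandardType_of_isOfFSMFFType` — "`D` of
FSMFF-type ⇒ `C` of standard type" — and the sharper `thm12_isOfStandardType_iff` — `C` is of standard type
IFF `D` is of FSMFF-type. The RATIONALLY-standard conclusion of the printed sentence (rational + standard)
still goes through the birationalization (`thm12_i_standard_rsParams`, `IsMonoidData`). No definition;
nothing here bears on [IUTchIII] Cor. 3.12.
-/

namespace Literature.AlgebraicGeometry.Frobenioids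

namespace PadicFrd

namespace Datum

open CategoryTheory Opposite

universe v u

variable {D : Type u} [Category.{v} D] {p : ℕ} [Fact p.Prime] (d : Datum D p)

/-- **Thm. 1.2 (i), third sentence, STANDARD-TYPE half, for EVERY datum** (no "`Φ`, `B` monoids on `D`"):
if `D` is of FSMFF-type, the `p`-adic Frobenioid `C` is of standard type ([FrdI] Def. 3.1 (i)) — [FrdI]
Thm. 5.2 (iii) for model categories without anchors (`ModelFrobenioid.data_isOfStandardType_of`: `Φ(A)`
sharp, `B` group-like, `D` totally epimorphic), with (a) vacuous (`Φ ≠ 0`) and (c) `Φ` non-dilating.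
Supersedes `thm12_isOfStandardType (h : d.IsMonoidData)`. [cite: MochizukiFrdII2008, Thm 1.2 (i) p.9] -/
theorem thm12_isOfStandardType_of_isOfFSMFFType (hD : IsOfFSMFFType D) :
    (ModelFrobenioid.data d.Φ d.B d.divB).IsOfStandardType :=
  ModelFrobenioid.data_isOfStandardType_of d.Φ d.B d.divB d.objectwise_isGroupLike_B
    (fun A => (d.isMonoprime (op A)).isSharp) d.isTotallyEpimorphic_base
    (fun h0 => (d.not_isZeroMonoid h0).elim) hD d.isNonDilatingOn

/-- **Thm. 1.2 (i), third sentence, STANDARD-TYPE half, as an equivalence, for EVERY datum**: the `p`-adic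
Frobenioid of `d` is of standard type IFF its base `D` is of FSMFF-type ([FrdI] Thm. 5.2 (iii): clause (a)
is vacuous as `Φ ≠ 0`, clause (c) "`Φ` non-dilating" always holds for `p`-adic data).
[cite: MochizukiFrdII2008, Thm 1.2 (i) p.9] -/
theorem thm12_isOfStandardType_iff :
    (ModelFrobenioid.data d.Φ d.B d.divB).IsOfStandardType ↔ IsOfFSMFFType D := by
  rw [ModelFrobenioid.data_isOfStandardType_iff d.Φ d.B d.divB d.objectwise_isGroupLike_B
    (fun A => (d.isMonoprime (op A)).isSharp) d.isTotallyEpimorphic_base]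
  exact ⟨fun h => h.2.1, fun hD => ⟨fun h0 => (d.not_isZeroMonoid h0).elim, hD, d.isNonDilatingOn⟩⟩

end Datum

end PadicFrd

end Literature.AlgebraicGeometry.Frobenioids
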